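import Literature.AnabelianGeometry.AbsoluteAnabelian.HyperbolicCoverOfNonabelianFundamentalGroup
import Literature.AnabelianGeometry.AbsoluteAnabelian.HolomorphicCoresIdComponentProofs
import Literature.AnabelianGeometry.AbsoluteAnabelian.HolomorphicCoresProofs
import Mathlib.Analysis.Convex.Contractible
import HarnessLib

/-!
# [AbsTopIII] Cor. 2.4 (b)(c) at a general hyperbolic Riemann surface with non-abelian `π₁`

[cite: MochizukiAbsTopIII2015, Corollary 2.4 (b)(c) p.54–55] — «Let `X` be a hyperbolic Riemann surface
of finite type; `U^top → X^top` its universal covering … (b) a natural injection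
`π₁(X^top) = Aut(U^top/X^top) ↪ Aut⁰(𝕌) ⊆ Aut(𝕌)`; (c) if `X` is not arithmetic, the hyperbolic core … the
orbispace quotient of `U^top` by the commensurator `Π`».

The tree proves (b) and (c) for ANY holomorphic universal covering of `X` by an Aut-holomorphic disc
(`DeckGroupInAutIdComponent_holds`, `HyperbolicCoreOrbispace_holds`); what a genuine `X` must supply is
the holomorphic universal covering `𝔻 → X`.  At genus `≤ 1` (plane domains, punctured elliptic curves)
this is unconditional (`PuncturedEllipticCurveUniversalCoverHolds`).  Here: the **general case** — a
connected Riemann surface of finite type whose fundamental group is NON-ABELIAN (every hyperbolic curve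
of type `(g, r)` with `g ≥ 2`, or `g = 1, r ≥ 1`, or `g = 0, r ≥ 3`) — conditional on the ONE Tier-2
named fact `RiemannSurface.SimplyConnectedUniformization` (Poincaré–Koebe), via
`exists_disc_covering_of_nonabelian_fundamentalGroup`:

* `exists_deckGroup_subset_autIdComponent_of_nonabelian_fundamentalGroup` — **Cor. 2.4 (b)**;
* `exists_hyperbolicCore_data_of_nonabelian_fundamentalGroup` — **Cor. 2.4 (c)** (under the printed
  non-arithmeticity hypothesis, typed `IsMargulisNonArithmetic`).

Second countability of the universal cover is carried as an instance hypothesis (automatic for second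
countable `X`).  HONEST FRAMING: instantiation of the tree's theorems; conditional on one classical named
fact; nothing here bears on the disputed [IUTchIII] Cor. 3.12.  No new definitions.
-/

noncomputable section

open Set Function Metric TopologicalSpace
open scoped Manifold ContDiff Topology

namespace Literature.AnabelianGeometry.AbsoluteAnabelian

open Literature.Topology.CoveringSpaces

variable (X : Type) [TopologicalSpace X] [T2Space X] [ConnectedSpace X] [ChartedSpace ℂ X]
  [IsManifold 𝓘(ℂ, ℂ) ω X]

/-- The unit disc is simply connected (it is convex, hence contractible).
[cite: MochizukiAbsTopIII2015, Corollary 2.4 p.54] -/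
theorem simplyConnectedSpace_unitDiscOpens : SimplyConnectedSpace unitDiscOpens := by
  haveI : ContractibleSpace unitDiscOpens := by
    unfold unitDiscOpens
    exact (convex_ball (0 : ℂ) 1).contractibleSpace ⟨0, mem_ball_self one_pos⟩
  exact SimplyConnectedSpace.ofContractible _

/-- The unit disc with its standard complex structure is an Aut-holomorphic disc (tautologically: the
identity is a biholomorphism onto `𝔻`). [cite: MochizukiAbsTopIII2015, Corollary 2.4 p.54] -/
theorem isAutHolDisc_unitDiscOpens : IsAutHolDisc unitDiscOpens :=
  ⟨⟨Homeomorph.refl _, mdifferentiable_id, mdifferentiable_id⟩⟩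

/-- **[AbsTopIII] Cor. 2.4 (b) at a general hyperbolic Riemann surface of finite type with non-abelian
fundamental group**, conditional on `RiemannSurface.SimplyConnectedUniformization`: `X` has a surjective
holomorphic universal covering `p : 𝔻 → X` by the unit disc, and every deck transformation of `p` lies
in the identity component `Aut⁰(𝔻)` of the automorphism group of the Aut-holomorphic disc —
`DeckGroupInAutIdComponent_holds` instantiated. [cite: MochizukiAbsTopIII2015, Corollary 2.4 (b) p.54] -/
theorem exists_deckGroup_subset_autIdComponent_of_nonabelian_fundamentalGroup
    (H2 : Literature.Geometry.Kaehler.RiemannSurface.SimplyConnectedUniformization)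
    (hX : IsOfFiniteType X) (x₀ : X) [SecondCountableTopology (UniversalCover X x₀)]
    (hπ : ∃ a b : FundamentalGroup X x₀, a * b ≠ b * a) :
    ∃ p : unitDiscOpens → X, IsCoveringMap p ∧ Function.Surjective p ∧
      MDifferentiable 𝓘(ℂ, ℂ) 𝓘(ℂ, ℂ) p ∧
      ((deckGroup p : Subgroup (unitDiscOpens ≃ₜ unitDiscOpens)) :
          Set (unitDiscOpens ≃ₜ unitDiscOpens)) ⊆
        autIdComponent (AutHolStructure.ofCharted unitDiscOpens) := by
  obtain ⟨p, hp, hsurj, hpd⟩ := exists_disc_covering_of_nonabelian_fundamentalGroup H2 x₀ hπ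
  haveI := simplyConnectedSpace_unitDiscOpens
  exact ⟨p, hp, hsurj, hpd,
    DeckGroupInAutIdComponent_holds X unitDiscOpens p hX hp hsurj hpd isAutHolDisc_unitDiscOpens⟩

/-- **[AbsTopIII] Cor. 2.4 (c) at a general hyperbolic Riemann surface of finite type with non-abelian
fundamental group**, conditional on `RiemannSurface.SimplyConnectedUniformization` and on the printed
non-arithmeticity hypothesis (typed `IsMargulisNonArithmetic`, kept as a hypothesis on the deck group in
`G = Aut⁰(𝔻)`): for the holomorphic universal covering `p : 𝔻 → X`, the commensurator `Π` of
`π₁(X) = Aut(𝔻/X)` in `Aut⁰(𝔻)` acts on `𝔻` properly discontinuously, with finite stabilisers, by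
automorphisms of the Aut-holomorphic disc — `HyperbolicCoreOrbispace_holds` instantiated.
[cite: MochizukiAbsTopIII2015, Corollary 2.4 (c) p.55] -/
theorem exists_hyperbolicCore_data_of_nonabelian_fundamentalGroup
    (H2 : Literature.Geometry.Kaehler.RiemannSurface.SimplyConnectedUniformization)
    (hX : IsOfFiniteType X) (x₀ : X) [SecondCountableTopology (UniversalCover X x₀)]
    (hπ : ∃ a b : FundamentalGroup X x₀, a * b ≠ b * a) :
    ∃ p : unitDiscOpens → X, IsCoveringMap p ∧ Function.Surjective p ∧
      MDifferentiable 𝓘(ℂ, ℂ) 𝓘(ℂ, ℂ) p ∧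
      ∀ G : Subgroup (unitDiscOpens ≃ₜ unitDiscOpens),
        (G : Set (unitDiscOpens ≃ₜ unitDiscOpens)) =
            autIdComponent (AutHolStructure.ofCharted unitDiscOpens) →
        IsMargulisNonArithmetic G (deckGroup p) →
        let Pc : Subgroup (unitDiscOpens ≃ₜ unitDiscOpens) :=
          (Subgroup.Commensurable.commensurator ((deckGroup p).subgroupOf G)).map G.subtype
        (∀ K L : Set unitDiscOpens, IsCompact K → IsCompact L →
            {γ : unitDiscOpens ≃ₜ unitDiscOpens | γ ∈ Pc ∧ (γ '' K ∩ L).Nonempty}.Finite) ∧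
          (∀ x : unitDiscOpens, {γ : unitDiscOpens ≃ₜ unitDiscOpens | γ ∈ Pc ∧ γ x = x}.Finite) ∧
          ((Pc : Set (unitDiscOpens ≃ₜ unitDiscOpens)) ⊆
            autSet (AutHolStructure.ofCharted unitDiscOpens)) := by
  obtain ⟨p, hp, hsurj, hpd⟩ := exists_disc_covering_of_nonabelian_fundamentalGroup H2 x₀ hπ
  haveI := simplyConnectedSpace_unitDiscOpens
  exact ⟨p, hp, hsurj, hpd, fun G hG hna =>
    HyperbolicCoreOrbispace_holds X unitDiscOpens p hX hp hsurj hpd isAutHolDisc_unitDiscOpens G hG hna⟩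

end Literature.AnabelianGeometry.AbsoluteAnabelian

end
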